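import Summits.NavierStokesRegularity.NavierStokesRegularity.Theses.PerpetualPump
import Summits.NavierStokesRegularity.NavierStokesRegularity.Theorems.AveragedTypeIBlowup.Negative.NSReduction
import Summits.NavierStokesRegularity.NavierStokesRegularity.Theorems.RungReynoldsOne.Negative.WithoutLerayHopfFalse
import Literature.Analysis.FluidPDE.NSQuasipotential

/-!
# `EulerTypeIGlue` (stmt-NavierStokesRegularity-1838): the Leray–Hopf hypothesis of the consequent
# is load-bearing; `0 < T` is not

Negative (support) lemmas for the crux `PerpetualPump.EulerTypeIGlue := Thesis → NoTypeIClay`,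
extracted from the crux work file `Cruxes/EulerTypeIGlue/Disproof.lean` (cdisprove cycle 1) so
that ideators / planners / provers can IMPORT them. Nothing here closes the item (`--supports`).

* `noTypeIClay_false_without_lerayHopf` — the consequent `NoTypeIClay` ("no Type-I blow-up for
  finite-energy classical Navier–Stokes solutions from rapidly decaying data") with the hypothesis
  `IsLerayHopfOn T ν 0 (u 0) u` deleted is FALSE. Witness: the parasitic pressure-driven drift
  `u = ((1−t)^{-1/2} − 1)e₀`, `p = −½(1−t)^{-3/2}x₀` of Koch–Nadirashvili–Seregin–Šverák
  (Acta Math. 203 (2009), §1 p. 3; the family `drift (gI c)` of the sibling file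
  `RungReynoldsOne/Negative/WithoutLerayHopfFalse.lean`): classical on `[0,1) × ℝ³` for every
  viscosity, Schwartz datum `0`, Type-I with constant `1` at `T = 1` (`isTypeIBlowup_driftI`), no
  classical continuation. So any proof of the glue must spend finite energy (in line `Sketch`: the
  `L²` class of the slices and RRS Thm 8.17 in `stub_backEnd`).
* `eulerTypeIGlue_without_lerayHopf_iff_not_thesis` — consequently the glue with `IsLerayHopfOn`
  dropped is EQUIVALENT to `¬ Thesis` (the negation of the route target, i.e. the deciding crux
  `AveragedTypeIBlowup` by `averagedTypeIBlowup_iff_not_thesis`).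
* `hasSmoothExtensionPast_of_nonpos`, `noTypeIClay_iff_without_T_pos` — the hypothesis `0 < T` of
  the consequent is decoration (for `T ≤ 0` every field extends past `T`).

[cite: KochNadirashviliSereginSverak2009, §1 p. 3 (parasitic solutions `u = b(t)`, `p = −b′(t)·x`)]
-/

noncomputable section

set_option linter.dupNamespace false

namespace Summit.NavierStokesRegularity.NavierStokesRegularity.Theorems.EulerTypeIGlue.Negative

open Set Filter Topology MeasureTheory Function
open Literature.Analysis.FluidPDE
open Summit.NavierStokesRegularity.NavierStokesRegularity.Theses.PerpetualPump
open Summit.NavierStokesRegularity.NavierStokesRegularity.Theorems.AveragedTypeIBlowup.Negative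
open Summit.NavierStokesRegularity.NavierStokesRegularity.Theorems.RungReynoldsOneNegative

/-! ## The Type-I drift is Type-I -/

/-- **The drift `u = c((1−t)^{-1/2} − 1)e₀` is Type-I at `T = 1` with constant `c`**:
`‖u(t,x)‖ = c((1−t)^{-1/2} − 1) ≤ c/√(1−t)` on `[0,1)`. [folklore] -/
theorem isTypeIBlowup_driftI {c : ℝ} (hc : 0 ≤ c) : IsTypeIBlowup (drift (gI c)) 1 := by
  refine ⟨c, ?_⟩
  filter_upwards [Ioo_mem_nhdsLT (zero_lt_one' ℝ)] with t ht x
  have hs : 0 < Real.sqrt (1 - t) := Real.sqrt_pos.2 (sub_pos.2 ht.2)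
  rw [norm_drift, abs_of_nonneg (gI_nonneg c hc ht.1.le ht.2), le_div_iff₀ hs, mul_comm,
    sqrt_mul_gI c ht.2]
  nlinarith [Real.sqrt_nonneg (1 - t)]

/-! ## Finite energy is load-bearing -/

/-- **`NoTypeIClay` without `IsLerayHopfOn` is FALSE.** The consequent of `EulerTypeIGlue` with the
Leray–Hopf hypothesis deleted fails at `ν = T = 1` on the Type-I drift with `c = 1`: classical on
`[0,1) × EuclideanSpace ℝ (Fin 3)` (`drift_isClassical`), rapidly decaying datum `u 0 = 0` (`drift_rapidDecay`), Type-I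
(`isTypeIBlowup_driftI`), and without classical continuation past `1`
(`drift_not_hasSmoothExtensionPast`, the amplitude is unbounded as `t ↑ 1`).
[cite: KochNadirashviliSereginSverak2009, §1 p. 3] -/
theorem noTypeIClay_false_without_lerayHopf :
    ¬ (∀ (ν T : ℝ), 0 < ν → 0 < T → ∀ (u : ℝ → EuclideanSpace ℝ (Fin 3) → EuclideanSpace ℝ (Fin 3)) (p : ℝ → EuclideanSpace ℝ (Fin 3) → ℝ),
      IsClassicalNSSolutionOn (Ico 0 T) ν 0 u p →
      HasRapidSpatialDecay (u 0) → IsTypeIBlowup u T → HasSmoothExtensionPast ν 0 u T) := fun h =>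
  drift_not_hasSmoothExtensionPast (tendsto_abs_gI_atTop 1 one_pos) 1
    (h 1 1 one_pos one_pos (drift (gI 1)) (driftP (gI 1)) (drift_isClassical (gI_contDiffOn 1) 1)
      (drift_rapidDecay (gI_zero 1)) (isTypeIBlowup_driftI zero_le_one))

/-- **The glue without Leray–Hopf is exactly the negation of the route target.**
`(Thesis → NoTypeIClay-without-IsLerayHopfOn) ↔ ¬ Thesis`: dropping finite energy from the
consequent turns the crux into the deciding crux `AveragedTypeIBlowup`
(`averagedTypeIBlowup_iff_not_thesis`). [folklore] -/
theorem eulerTypeIGlue_without_lerayHopf_iff_not_thesis :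
    (Thesis → ∀ (ν T : ℝ), 0 < ν → 0 < T → ∀ (u : ℝ → EuclideanSpace ℝ (Fin 3) → EuclideanSpace ℝ (Fin 3)) (p : ℝ → EuclideanSpace ℝ (Fin 3) → ℝ),
      IsClassicalNSSolutionOn (Ico 0 T) ν 0 u p →
      HasRapidSpatialDecay (u 0) → IsTypeIBlowup u T → HasSmoothExtensionPast ν 0 u T) ↔
    ¬ Thesis :=
  ⟨fun h hT => noTypeIClay_false_without_lerayHopf (h hT), fun h hT => absurd hT h⟩

/-! ## `0 < T` is decoration -/

/-- For `T ≤ 0` every field extends past `T` (the rest state on `[0,1)` agrees with `u` on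
`Ico 0 T = ∅`). [folklore] -/
theorem hasSmoothExtensionPast_of_nonpos (ν : ℝ) (u : ℝ → EuclideanSpace ℝ (Fin 3) → EuclideanSpace ℝ (Fin 3)) {T : ℝ} (hT : T ≤ 0) :
    HasSmoothExtensionPast ν 0 u T :=
  ⟨1, by linarith, 0, 0, isClassicalNSSolutionOn_zero _ _,
    fun t ht => absurd ht.2 (by linarith [ht.1])⟩

/-- The consequent of `EulerTypeIGlue` is unchanged when its hypothesis `0 < T` is deleted. [folklore] -/
theorem noTypeIClay_iff_without_T_pos :
    (∀ (ν T : ℝ), 0 < ν → 0 < T → ∀ (u : ℝ → EuclideanSpace ℝ (Fin 3) → EuclideanSpace ℝ (Fin 3)) (p : ℝ → EuclideanSpace ℝ (Fin 3) → ℝ),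
      IsClassicalNSSolutionOn (Ico 0 T) ν 0 u p → IsLerayHopfOn T ν 0 (u 0) u →
      HasRapidSpatialDecay (u 0) → IsTypeIBlowup u T → HasSmoothExtensionPast ν 0 u T) ↔
    ∀ (ν T : ℝ), 0 < ν → ∀ (u : ℝ → EuclideanSpace ℝ (Fin 3) → EuclideanSpace ℝ (Fin 3)) (p : ℝ → EuclideanSpace ℝ (Fin 3) → ℝ),
      IsClassicalNSSolutionOn (Ico 0 T) ν 0 u p → IsLerayHopfOn T ν 0 (u 0) u →
      HasRapidSpatialDecay (u 0) → IsTypeIBlowup u T → HasSmoothExtensionPast ν 0 u T := by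
  refine ⟨fun h ν T hν u p hcl hLH hdec hTI => ?_, fun h ν T hν _ => h ν T hν⟩
  rcases le_or_gt T 0 with hT | hT
  · exact hasSmoothExtensionPast_of_nonpos ν u hT
  · exact h ν T hν hT u p hcl hLH hdec hTI

end Summit.NavierStokesRegularity.NavierStokesRegularity.Theorems.EulerTypeIGlue.Negative

end
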